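import Summits.BirchSwinnertonDyer.Rank1Residual.X2.CongruentPartnerAnomalous
import Literature.NumberTheory.EllipticCurves.Rank1Residual.AnomalousDictionaryProofs
import HarnessLib

/-!
# Class X2 (odd multiplicative Eisenstein prime): at a NON-SPLIT `p ‖ N₀` every GOOD congruent
# relative has `a_p ≡ −1 (mod p)` — the exact trace congruence
# (cell `b2b-bsdres`, unit `b2b-bsdres-eisenstein-p2`, gen 15)

HONEST FRAMING (run/shared/lean/b2b/bsd-rank1-residual/, verbatim in every file): the goal of the
cell is to DELETE the COMBINATION-SHAPED residual classes of the Birch–Swinnerton-Dyer formula for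
ALL analytic-rank `≤ 1` elliptic curves over `ℚ` — "full BSD formula for every rank `≤ 1` curve in
class `C`" assembled STRICTLY from published theorems — so that the rank-`≤ 1` remainder becomes
exactly the CONSTRUCTION-SHAPED classes, which are TYPED (missing-input `Prop`s), NOT attempted.
This is not "finishing BSD". Research route; NO CLAIM BEYOND STATED CLASSES; nothing here changes a
label. Theorems only (no definition, no named fact, nothing asserted).

## What this file proves

`CongruentPartnerAnomalous.lean` (gen 15) shows `p ∤ a_p(E') − 1` for a GOOD relative `E'`
(`E'[p] ≅ E₀[p]` as `Γ_ℚ`-modules) of a NON-SPLIT X2 pair `(E₀, p)`. This file sharpens it to the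
exact congruence stated in the prose of gens 7/14 (X2-GAP §12.1/§19.1) and visible in the census
column `a_3(E') ∈ {−1, 2}`:

* `dvd_frobeniusTrace_add_one_of_equiv_of_not_split` / `…_of_torsionIso_of_not_split` —
  **`p ∣ a_p(E') + 1`**, i.e. `a_p(E') ≡ −1 (mod p)`: the unramified quotient character of
  `E₀[p]|_{G_p}` is the quadratic `δ` of the non-split Tate curve, `δ(Frob_p) = −1`, and on the good
  side Frobenius acts on `E'[p]/X_p` as `a_p(E')` (Serre 1972 §1.11 (1)).
* `split_of_torsionIso_of_dvd_frobeniusTrace_sub_one` — the X1-leaf reading: a MULTIPLICATIVE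
  relative of an anomalous good Eisenstein pair is SPLIT at `p` (its `e_p = 1`).

Mechanism (all inputs are tree theorems; A41 = twisted Tate uniformisation as hypothesis `hT`):
(1) `exists_line_of_not_split` — at the place `v ∋ p`, a local arithmetic Frobenius `τ ∈ Γ_{ℚ_v}`
acts as `−1` on `E₀[p]/X₀` (`X₀ = C ∩ E₀[p]`, order `p`; gen 12 sign + gen 15
`TateLineDecomposition`) and the local inertia group acts trivially on `E₀[p]/X₀` (gen 9 `htriv`);
(2) globalisation: `res τ` is an arithmetic Frobenius at `𝔓₁ = ι⁻¹(𝔐) ∩ \bar ℤ`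
(`isArithFrobAt_resGalOfEmb`) and `I_{𝔓₁}` comes from the local inertia
(`exists_mem_inertia_apply_eq_holds`, `inertia_eq_absInertia`); (3) conjugation by `g ∈ Γ_ℚ` with
`g • 𝔓₁ = 𝔓`, `𝔓` the prime of the place `placeOver p` (`exists_smul_eq_of_mem_primesAbove_holds`,
Mathlib `IsArithFrobAt.conj`, `conj_mem_inertia_of_mem`); (4) transport along `e : E₀[p] ≅ E'[p]`;
(5) x1a's reduction line `X_p = ker(red|E'[p])` (`AnomalousDictionaryProofs`: order `p`, moved by
`I_𝔓`, `I_𝔓` trivial on `E'[p]/X_p`, Frobenius acts as `a_p` on `E'[p]/X_p`) — the transported line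
has an `I_𝔓`-trivial quotient too, so it IS `X_p`, on which the conjugated Frobenius acts both as
`−1` and as `a_p`: `(a_p + 1) · E'[p] ⊆ X_p ≠ E'[p]`, whence `p ∣ a_p + 1`.

References: [Serre1972] §1.11 (1), Prop. 11–12, §1.12; [GreenbergVatsal2000] §2 pp. 14–15;
[SilvermanATAEC1994] Ch. V Lemma 5.2 (c), Thm. 5.3, Cor. 5.4; [NeukirchANT1999] Ch. I §9 (9.4),
Ch. II §9 (9.6); HOME/b2b-bsdres-eisenstein-p2/X2-GAP.md §20.
-/

set_option autoImplicit false

noncomputable section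

open scoped Classical Pointwise

open NumberField IsDedekindDomain Field WeierstrassCurve
  Literature.NumberTheory.EllipticCurves Literature.NumberTheory.GaloisRepresentations
  Literature.NumberTheory.EllipticCurves.GreenbergSelmer
  Literature.NumberTheory.EllipticCurves.Rank1Residual
  Summit.BirchSwinnertonDyer.Rank1Residual.X1.CongruenceTransfer
  Summit.BirchSwinnertonDyer.Rank1Residual.X2.GreenbergVatsalTateDatum
  Summit.BirchSwinnertonDyer.Rank1Residual.X2.GreenbergVatsalTateDatumSign
  Summit.BirchSwinnertonDyer.Rank1Residual.X2.GreenbergVatsalTateDatumTorsion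
  Summit.BirchSwinnertonDyer.Rank1Residual.X2.GreenbergVatsalTateDatumCofree
  Summit.BirchSwinnertonDyer.Rank1Residual.X2.GreenbergVatsalTateFrobeniusSign

namespace Summit.BirchSwinnertonDyer.Rank1Residual.X2.CongruentPartnerTrace

variable {W W' : WeierstrassCurve ℚ} [W.IsElliptic] [W.IsGloballyMinimal] [W'.IsElliptic]
  [W'.IsGloballyMinimal] {p : ℕ} [hp : Fact p.Prime]

/-! ## §1. The `E₀` side, packaged: a local Frobenius acts as `−1` and the local inertia trivially
on `E₀[p]/X₀` -/

variable (W p) in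
omit [W'.IsElliptic] [W'.IsGloballyMinimal] in
/-- **NON-SPLIT odd `p ‖ N₀`: a line `X₀ ≤ E₀[p]` of order `p` on whose quotient a local arithmetic
Frobenius `τ` acts as `−1` and the local inertia group acts trivially** (`X₀ = C ∩ E₀[p]` for the
Tate datum; gen 12 `smul_sub_sign_smul_mem` with `frob_apply_sqrt_gamma_ne`, gen 9 `tateDatum_htriv`,
gen 13 `#C[p] = p`). Granted A41 (`hT`). [cite: GreenbergVatsal2000, §2 pp. 14–15]
[cite: SilvermanATAEC1994, Ch. V Lemma 5.2 (c), Thm. 5.3 (a),(b), Cor. 5.4 (held copy PDF pp. 406–410)] -/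
theorem exists_line_of_not_split (hT : Silverman1994_thmV53_corV54_tateUniformisation.{0})
    (hp2 : p ≠ 2) (hmult : W.HasMultiplicativeReductionAtPrime p)
    (hns : ¬ W.HasSplitMultiplicativeReductionAtPrime p) {v : HeightOneSpectrum (𝓞 ℚ)}
    (hpv : ((p : ℕ) : 𝓞 ℚ) ∈ v.asIdeal) {𝔐 : Ideal v.localAbsIntegers} (h𝔐 : 𝔐 ∈ v.localPrimesAbove)
    {τ : absoluteGaloisGroup (v.adicCompletion ℚ)}
    (hτ : IsArithFrobAt (v.adicCompletionIntegers ℚ) τ 𝔐) :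
    ∃ X : AddSubgroup (geomTorsion W (p : ℤ)), Nat.card X = p ∧
      (∀ P : geomTorsion W (p : ℤ), absGaloisRestrict ℚ (v.adicCompletion ℚ) τ • P + P ∈ X) ∧
      (∀ σ ∈ absInertia (v.adicCompletion ℚ), ∀ P : geomTorsion W (p : ℤ),
        absGaloisRestrict ℚ (v.adicCompletion ℚ) σ • P - P ∈ X) := by
  obtain ⟨q, t, Ψ, hq0, hq1, ht0, ht2, hsurj, hker, hΨσ, -⟩ :=
    hT W v (GreenbergVatsalStrictSelmerMultiplicative.hasMultiplicativeReductionAt_of_mem W p hmult hpv)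
  have hker' : ∀ u : (AlgebraicClosure (v.adicCompletion ℚ))ˣ, Ψ (Additive.ofMul u) = 0 →
      ∃ a : ℤ, (u : AlgebraicClosure (v.adicCompletion ℚ)) =
        algebraMap (v.adicCompletion ℚ) (AlgebraicClosure (v.adicCompletion ℚ)) q ^ a :=
    fun u h ↦ (hker u).1 h
  have hΨI : ∀ σ ∈ absInertia (v.adicCompletion ℚ),
      ∀ u : (AlgebraicClosure (v.adicCompletion ℚ))ˣ,
      σ • Ψ (Additive.ofMul u) = Ψ (Additive.ofMul (Units.map
        (Field.absoluteGaloisGroup.toAlgEquiv (v.adicCompletion ℚ) σ :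
          AlgebraicClosure (v.adicCompletion ℚ) →* AlgebraicClosure (v.adicCompletion ℚ)) u)) := by
    intro σ hσ u
    rw [hΨσ σ u, if_pos (GreenbergVatsalTateDatumRat.inertia_fix_sqrt_gamma W hp2 hmult hpv t ht2 σ hσ),
      one_zsmul]
  set N := tateDatum W p Ψ (sign_disj W Ψ t hΨσ) with hN
  refine ⟨N.plus.comap (AddSubgroup.inclusion (geomTorsion_le_geomPrimaryTorsion W p)), ?_, ?_, ?_⟩
  · rw [TateLineDecomposition.natCard_comap_eq W p N, hN]
    exact natCard_tateDatum_plus_inf_torsionBy W p Ψ _ hq0 hq1 hker'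
  · intro P
    have hflip := frob_apply_sqrt_gamma_ne W hp2 hmult hns hpv h𝔐 hτ t ht0 ht2
    have h := TateLineDecomposition.smul_sub_zsmul_mem_comap W p N (fun m ↦ by
      have h := smul_sub_sign_smul_mem W p Ψ t hΨσ hsurj hker' τ m
      rw [if_neg hflip] at h
      exact h) P
    rwa [neg_one_zsmul, sub_neg_eq_add] at h
  · intro σ hσ P
    have h := TateLineDecomposition.smul_sub_zsmul_mem_comap W p N
      (g := absGaloisRestrict ℚ (v.adicCompletion ℚ) σ) (s := 1) (fun m ↦ by
        rw [one_zsmul]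
        exact tateDatum_htriv W p Ψ _ hsurj hker' hΨI _ (Subgroup.mem_map_of_mem _ hσ) m) P
    rwa [one_zsmul] at h

/-! ## §2. Conjugation bookkeeping in `Γ_ℚ` -/

omit [W.IsElliptic] [W.IsGloballyMinimal] [W'.IsElliptic] [W'.IsGloballyMinimal] hp in
/-- If `j ∈ I_{g • 𝔓}` then `g⁻¹ j g ∈ I_𝔓` (Neukirch I (9.4): `I_{g𝔓} = g I_𝔓 g⁻¹`). [folklore] -/
theorem conj_mem_inertia_of_mem {𝔓 : Ideal (absIntegers (𝓞 ℚ) ℚ)} {g j : absoluteGaloisGroup ℚ}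
    (hj : j ∈ (g • 𝔓).inertia (absoluteGaloisGroup ℚ)) :
    g⁻¹ * j * g ∈ 𝔓.inertia (absoluteGaloisGroup ℚ) := by
  rw [Ideal.inertia, AddSubgroup.mem_inertia] at hj ⊢
  intro x
  have h := hj (g • x)
  rw [Submodule.mem_toAddSubgroup, Ideal.mem_pointwise_smul_iff_inv_smul_mem, smul_sub,
    ← mul_smul, ← mul_smul, inv_smul_smul] at h
  rwa [Submodule.mem_toAddSubgroup]

omit [W.IsElliptic] [W.IsGloballyMinimal] [W'.IsElliptic] [W'.IsGloballyMinimal] hp in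
/-- Membership in `g • X` (the image of a subgroup `X ≤ E[p]` under `g ∈ Γ_ℚ`): `Q ∈ g • X` iff
`g⁻¹ • Q ∈ X`. [folklore] -/
theorem mem_map_smul_iff (X : AddSubgroup (geomTorsion W (p : ℤ))) (g : absoluteGaloisGroup ℚ)
    (Q : geomTorsion W (p : ℤ)) :
    Q ∈ X.map (DistribSMul.toAddMonoidHom (geomTorsion W (p : ℤ)) g) ↔ g⁻¹ • Q ∈ X := by
  constructor
  · rintro ⟨P, hP, rfl⟩
    change g⁻¹ • g • P ∈ X
    rwa [inv_smul_smul]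
  · intro h
    exact ⟨g⁻¹ • Q, h, by change g • g⁻¹ • Q = Q; rw [smul_inv_smul]⟩

omit [W.IsElliptic] [W.IsGloballyMinimal] [W'.IsElliptic] [W'.IsGloballyMinimal] hp in
/-- `#(g • X) = #X`. [folklore] -/
theorem natCard_map_smul (X : AddSubgroup (geomTorsion W (p : ℤ))) (g : absoluteGaloisGroup ℚ) :
    Nat.card (X.map (DistribSMul.toAddMonoidHom (geomTorsion W (p : ℤ)) g)) = Nat.card X := by
  have hinj : Function.Injective (DistribSMul.toAddMonoidHom (geomTorsion W (p : ℤ)) g) :=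
    fun a b h ↦ smul_left_cancel g h
  exact (Nat.card_congr (X.equivMapOfInjective _ hinj).toEquiv).symm

/-! ## §3. The trace congruence -/

omit [W'.IsGloballyMinimal] in
/-- A subgroup of `E[p]` of order `p` misses some point (`#E[p] = p²`). [folklore] -/
theorem exists_not_mem_of_card_eq {X : AddSubgroup (geomTorsion W' (p : ℤ))} (hX : Nat.card X = p) :
    ∃ Q : geomTorsion W' (p : ℤ), Q ∉ X := by
  by_contra h
  push Not at h
  have htop : X = ⊤ := (AddSubgroup.eq_top_iff' X).mpr h
  rw [htop, AddSubgroup.card_top, Literature.NumberTheory.EllipticCurves.natCard_geomTorsion W' p] at hX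
  have : p ^ 2 = p ^ 1 := by rw [pow_one]; exact hX
  exact absurd (Nat.pow_right_injective hp.out.two_le this) (by norm_num)

/-- **NON-SPLIT X2 pair ⇒ every GOOD congruent relative has `a_p ≡ −1 (mod p)`.** `W, W'/ℚ`
globally minimal elliptic, `p` odd; `W` has NON-SPLIT multiplicative reduction at `p` with `W[p]`
reducible, `W'` has GOOD reduction at `p`, `e : W[p] ≅ W'[p]` is a `Γ_ℚ`-isomorphism. Then
`p ∣ a_p(W') + 1`. Granted A41 (`hT`). Proof in the module docstring (local Frobenius `−1` on
`E₀[p]/X₀` ↦ global Frobenius at the place's prime acting as `a_p` on `E'[p]/X_p`, the two lines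
matched by their inertia-trivial quotients). [cite: Serre1972, §1.11 (1), Prop. 11–12]
[cite: GreenbergVatsal2000, §2 pp. 14–15] [cite: NeukirchANT1999, Ch. II §9 Prop. (9.6)]
[cite: SilvermanATAEC1994, Ch. V Lemma 5.2 (c), Thm. 5.3 (a),(b), Cor. 5.4 (held copy PDF pp. 406–410)] -/
theorem dvd_frobeniusTrace_add_one_of_equiv_of_not_split
    (hT : Silverman1994_thmV53_corV54_tateUniformisation.{0}) (hp2 : p ≠ 2)
    (hmult : W.HasMultiplicativeReductionAtPrime p)
    (hns : ¬ W.HasSplitMultiplicativeReductionAtPrime p) (hred : ¬ W.HasIrreducibleModPGaloisRep p)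
    (hgood' : W'.HasGoodReductionAtPrime p)
    (e : geomTorsion W (p : ℤ) ≃+ geomTorsion W' (p : ℤ))
    (he : ∀ (σ : absoluteGaloisGroup ℚ) (P : geomTorsion W (p : ℤ)), e (σ • P) = σ • e P) :
    (p : ℤ) ∣ W'.frobeniusTrace p + 1 := by
  have hpp := hp.out
  have hp2' : 2 < p := lt_of_le_of_ne hpp.two_le (Ne.symm hp2)
  -- the place, a local prime and a local Frobenius
  set v : HeightOneSpectrum (𝓞 ℚ) := (Rat.HeightOneSpectrum.primesEquiv).symm ⟨p, hpp⟩ with hvdef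
  have hv : (Rat.HeightOneSpectrum.primesEquiv v : ℕ) = p := by
    rw [hvdef, Equiv.apply_symm_apply]
  have hpv : ((p : ℕ) : 𝓞 ℚ) ∈ v.asIdeal := natCast_mem_asIdeal_of_primesEquiv_eq hv
  obtain ⟨w, hw⟩ := v.exists_spectralValuation
  obtain ⟨𝔐, h𝔐⟩ := v.localPrimesAbove_nonempty
  obtain ⟨τ, hτ⟩ := IsDedekindDomain.HeightOneSpectrum.exists_isArithFrobAt_localAbsIntegers v h𝔐
  -- §1: the `E₀` side
  obtain ⟨X, hXcard, hflip, hinert⟩ := exists_line_of_not_split W p hT hp2 hmult hns hpv h𝔐 hτ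
  -- globalisation at `𝔓₁ = ι⁻¹(𝔐) ∩ \bar ℤ`
  set ι : AlgebraicClosure ℚ →ₐ[ℚ] AlgebraicClosure (v.adicCompletion ℚ) :=
    closureEmb (K := ℚ) (v.adicCompletion ℚ) with hι
  have hres : ∀ σ : absoluteGaloisGroup (v.adicCompletion ℚ),
      resGalOfEmb ι σ = absGaloisRestrict ℚ (v.adicCompletion ℚ) σ := fun σ ↦ rfl
  have h𝔓₁ : v.primeBelow ι 𝔐 ∈ v.primesAbove :=
    IsDedekindDomain.HeightOneSpectrum.primeBelow_mem_primesAbove (ι := ι) h𝔐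
  set σ₁ : absoluteGaloisGroup ℚ := absGaloisRestrict ℚ (v.adicCompletion ℚ) τ with hσ₁def
  have hσ₁ : IsArithFrobAt (𝓞 ℚ) σ₁ (v.primeBelow ι 𝔐) := by
    have h := WeierstrassCurve.isArithFrobAt_resGalOfEmb h𝔐 ι hτ
    rwa [hres] at h
  have hI₁ : ∀ j ∈ (v.primeBelow ι 𝔐).inertia (absoluteGaloisGroup ℚ), ∀ P : geomTorsion W (p : ℤ),
      j • P - P ∈ X := by
    intro j hj P
    obtain ⟨σ, hσI, hσj⟩ :=
      IsDedekindDomain.HeightOneSpectrum.exists_mem_inertia_apply_eq_holds v ι h𝔐 hj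
    have hjres : resGalOfEmb ι σ = j := resGalOfEmb_eq_of_apply_eq ι hσj
    rw [IsDedekindDomain.HeightOneSpectrum.inertia_eq_absInertia hw h𝔐] at hσI
    rw [← hjres, hres]
    exact hinert σ hσI P
  -- the place's prime `𝔓` and `g • 𝔓₁ = 𝔓`
  obtain ⟨𝔓, hmem, h𝔓⟩ := exists_ideal_placeOver p hv
  obtain ⟨g, hg⟩ :=
    HeightOneSpectrum.exists_smul_eq_of_mem_primesAbove_holds (K := ℚ) (v := v) h𝔓₁ h𝔓
  set σ : absoluteGaloisGroup ℚ := g * σ₁ * g⁻¹ with hσdef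
  have hσ : IsArithFrobAt (𝓞 ℚ) σ 𝔓 := by
    rw [← hg]
    exact hσ₁.conj g
  -- the conjugated line `Y = g • X` and its transport `Y' = e(Y)`
  set Y : AddSubgroup (geomTorsion W (p : ℤ)) :=
    X.map (DistribSMul.toAddMonoidHom (geomTorsion W (p : ℤ)) g) with hYdef
  have hYflip : ∀ P : geomTorsion W (p : ℤ), σ • P + P ∈ Y := fun P ↦ by
    rw [hYdef, mem_map_smul_iff, smul_add, hσdef, mul_smul, mul_smul, inv_smul_smul]
    exact hflip (g⁻¹ • P)
  have hYinert : ∀ j ∈ 𝔓.inertia (absoluteGaloisGroup ℚ), ∀ P : geomTorsion W (p : ℤ),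
      j • P - P ∈ Y := fun j hj P ↦ by
    rw [← hg] at hj
    have h := hI₁ _ (conj_mem_inertia_of_mem hj) (g⁻¹ • P)
    rw [hYdef, mem_map_smul_iff, smul_sub]
    rwa [mul_smul, mul_smul, smul_inv_smul] at h
  set Y' : AddSubgroup (geomTorsion W' (p : ℤ)) := Y.map e.toAddMonoidHom with hY'def
  have hY'card : Nat.card Y' = p := by
    rw [hY'def]
    have hinj : Function.Injective (e.toAddMonoidHom.comp Y.subtype) := by
      intro a b h
      exact Subtype.ext (e.injective h)
    have hrange : (e.toAddMonoidHom.comp Y.subtype).range = Y.map e.toAddMonoidHom := by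
      rw [AddMonoidHom.range_comp, AddSubgroup.range_subtype]
    rw [← hrange, Nat.card_congr (AddMonoidHom.ofInjective hinj).toEquiv.symm, hYdef,
      natCard_map_smul, hXcard]
  have hY'flip : ∀ Q : geomTorsion W' (p : ℤ), σ • Q + Q ∈ Y' := fun Q ↦ by
    obtain ⟨P, rfl⟩ := e.surjective Q
    rw [← he, ← map_add]
    exact AddSubgroup.mem_map.mpr ⟨σ • P + P, hYflip P, rfl⟩
  have hY'inert : ∀ j ∈ 𝔓.inertia (absoluteGaloisGroup ℚ), ∀ Q : geomTorsion W' (p : ℤ),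
      j • Q - Q ∈ Y' := fun j hj Q ↦ by
    obtain ⟨P, rfl⟩ := e.surjective Q
    rw [← he, ← map_sub]
    exact AddSubgroup.mem_map.mpr ⟨j • P - P, hYinert j hj P, rfl⟩
  -- §5: x1a's reduction line `X_p` of `W'` at `𝔓`
  have hΔ' : ¬ (p : ℤ) ∣ minimalDiscriminantInt W' :=
    W'.not_dvd_minimalDiscriminantInt_of_hasGoodReductionAtPrime' p hgood'
  obtain ⟨Φ, hΦ⟩ := exists_isRationalLine_of_not_irr W p hred
  have hred' : ¬ W'.HasIrreducibleModPGaloisRep p :=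
    CongruentPartnerAnomalous.not_hasIrreducibleModPGaloisRep_of_isRationalLine
      (CongruentPartnerAnomalous.isRationalLine_map_equiv e he hΦ)
  have hord' : ¬ (p : ℤ) ∣ W'.frobeniusTrace p := (goodOrd_of_red_of_good W' p hp2' hgood' hred').2
  obtain ⟨hX'card, j, hj, R, hRX', hjR⟩ :=
    exists_mem_inertia_smul_ne_of_mem_ker hp2 hΔ' hgood' hord' hmem hv h𝔓
  set X' := ((geomReduction hΔ').comp (geomTorsion W' (p : ℤ)).subtype).ker with hX'def
  -- `Y' = X_p`
  have hYX : Y' = X' := by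
    rcases TateLineDecomposition.inf_eq_bot_or_eq W' p hY'card hX'card with hbot | heq
    · exfalso
      have h1 : j • R - R ∈ (Y' ⊓ X' : AddSubgroup _) :=
        ⟨hY'inert j hj R, smul_sub_self_mem_ker_of_mem_inertia hΔ' hmem hj R⟩
      rw [hbot, AddSubgroup.mem_bot, sub_eq_zero] at h1
      exact hjR h1
    · exact heq
  -- `(a_p + 1) • Q ∈ X_p` for every `Q`
  have hall : ∀ Q : geomTorsion W' (p : ℤ), (W'.frobeniusTrace p + 1) • Q ∈ X' := fun Q ↦ by
    have h1 : σ • Q + Q ∈ X' := hYX ▸ hY'flip Q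
    have h2 : σ • Q - (W'.frobeniusTrace p) • Q ∈ X' :=
      smul_sub_frobeniusTrace_smul_mem_ker hΔ' hmem hv h𝔓 hσ Q
    have h3 := X'.sub_mem h1 h2
    have e1 : σ • Q + Q - (σ • Q - (W'.frobeniusTrace p) • Q) = (W'.frobeniusTrace p + 1) • Q := by
      rw [add_zsmul, one_zsmul]; abel
    rwa [e1] at h3
  -- conclude with a point outside `X_p`
  obtain ⟨Q, hQ⟩ := exists_not_mem_of_card_eq hX'card
  by_contra hndvd
  have hpi : Prime (p : ℤ) := Nat.prime_iff_prime_int.mp hpp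
  obtain ⟨a, b, hab⟩ := (hpi.irreducible.coprime_iff_not_dvd).mpr hndvd
  have hpQ : (p : ℤ) • Q = 0 := by
    rw [natCast_zsmul]
    exact AddSubgroup.torsionBy.nsmul Q
  apply hQ
  have hQeq : Q = b • ((W'.frobeniusTrace p + 1) • Q) := by
    conv_lhs => rw [← one_zsmul Q, ← hab]
    rw [add_zsmul, mul_zsmul, mul_zsmul, hpQ, zsmul_zero, zero_add]
  rw [hQeq]
  exact X'.zsmul_mem (hall Q) b

/-- **`TorsionIso` form**: at a NON-SPLIT X2 pair every good congruent relative has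
`a_p ≡ −1 (mod p)` — with `p ∤ a_p` (Serre Prop. 12) this pins the census column
`a_3(E') ∈ {−1, 2}` of HOME/b2b-bsdres-eisenstein-p2/covered/. [cite: Serre1972, §1.11 (1), Prop. 11–12]
[cite: GreenbergVatsal2000, Thm. (1.4) and §2 pp. 14–15] -/
theorem dvd_frobeniusTrace_add_one_of_torsionIso_of_not_split
    (hT : Silverman1994_thmV53_corV54_tateUniformisation.{0}) (hp2 : p ≠ 2)
    (hmult : W.HasMultiplicativeReductionAtPrime p)
    (hns : ¬ W.HasSplitMultiplicativeReductionAtPrime p) (hred : ¬ W.HasIrreducibleModPGaloisRep p)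
    (hgood' : W'.HasGoodReductionAtPrime p) (hiso : TorsionIso W W' p) :
    (p : ℤ) ∣ W'.frobeniusTrace p + 1 := by
  obtain ⟨e, he⟩ := hiso
  exact dvd_frobeniusTrace_add_one_of_equiv_of_not_split hT hp2 hmult hns hred hgood' e he

/-! ## §4. The X1-leaf reading: a multiplicative relative of an ANOMALOUS good pair is SPLIT -/

/-- **X1 leaf ⇒ split relatives.** If `W` is GOOD at the odd prime `p` with `W[p]` reducible and
`a_p(W) ≡ 1 (mod p)` (an anomalous Eisenstein pair, the X1 leaf), then every MULTIPLICATIVE congruent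
relative `W'` (`W[p] ≅ W'[p]`) is SPLIT at `p` — contrapositive of
`CongruentPartnerAnomalous.not_dvd_frobeniusTrace_sub_one_of_torsionIso_of_not_split` along the
symmetric congruence. Reading for eisenstein-p1 / gen 7's `Leaf` route-G forms: the X2 relative of
an X1-leaf class always carries the trivial zero (`e_p = 1`). Granted A41 (`hT`).
[cite: GreenbergVatsal2000, Thm. (1.4) and §2 pp. 14–15] [cite: Serre1972, §1.11 (1), Prop. 11–12] -/
theorem split_of_torsionIso_of_dvd_frobeniusTrace_sub_one
    (hT : Silverman1994_thmV53_corV54_tateUniformisation.{0}) (hp2 : p ≠ 2)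
    (hgood : W.HasGoodReductionAtPrime p) (hred : ¬ W.HasIrreducibleModPGaloisRep p)
    (hanom : (p : ℤ) ∣ W.frobeniusTrace p - 1) (hmult' : W'.HasMultiplicativeReductionAtPrime p)
    (hiso : TorsionIso W W' p) : W'.HasSplitMultiplicativeReductionAtPrime p := by
  by_contra hns'
  obtain ⟨e, he⟩ := hiso
  obtain ⟨Φ, hΦ⟩ := exists_isRationalLine_of_not_irr W p hred
  have hred' : ¬ W'.HasIrreducibleModPGaloisRep p :=
    CongruentPartnerAnomalous.not_hasIrreducibleModPGaloisRep_of_isRationalLine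
      (CongruentPartnerAnomalous.isRationalLine_map_equiv e he hΦ)
  exact CongruentPartnerAnomalous.not_dvd_frobeniusTrace_sub_one_of_torsionIso_of_not_split hT hp2
    hmult' hns' hred' hgood (TorsionIso.symm ⟨e, he⟩) hanom

end Summit.BirchSwinnertonDyer.Rank1Residual.X2.CongruentPartnerTrace

end
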